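import Mathlib
import Literature.NumberTheory.Sieve.ParityBarrier
import Summits.Parity.GeneralizedHardyLittlewood.Theorems.LiouvilleMADDecorrelationToDilatedChowla

/-!
# The mean-free engine: what the residual of line `SketchIdeator3` is for

Stub `stub_meanFreeEngine` of line `SketchIdeator3` of crux stmt-Parity-13317
(`Summit.Parity.GeneralizedHardyLittlewood.Theses.LiouvilleMAD.CosetDecorrelation`,
card `farey-level-mean-coupling`, IdeatorMemo3 §F3 made exact); Duke–Friedlander–Iwaniec divisor
switching via the tree's `decorrelationToDilatedChowla_divisor_switch` (any weight) and
`decorrelationToDilatedChowla_fan_eq_zero` (empty fans); `|λ| ≤ 1` is the Literature lemma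
`Literature.NumberTheory.Sieve.abs_liouville_le_one`.

Write `u(m) = λ(mn+c)`, `v(m') = λ(m'n'+c)` on the dyadic block `(M,2M]`, `S = Σ u`, `S' = Σ v`, and
take the MEAN-FREE weight `f(m,m') = (u(m) − S/M)(v(m') − S'/M)`.  With `Q = ⌊√M⌋ + 1`,
`J = [Q, 2Q)` (`|J| = Q`, `Q² > M`) the divisor switch reads
`Q·Σ_m f(m,m) + Σ_{0<|k|≤M} Σ_{j∈J} Σ_{m−m'=kj} f = Σ_{j∈J} Σ_{m≡m' (j)} f`.

* `meanFree_divisorSwitch_bound` (any weight `f`, `M ≥ 1`): if every coset sum (`j ∈ J`) is `≤ A`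
  in absolute value and every fan sum (`k ≠ 0`, summed over `j ∈ J`) is `≤ B`, then
  `|Σ_m f(m,m)| ≤ A + 2B` — the fans with `|k| ≥ Q` are empty, at most `2Q − 1` values of `k`
  remain, and one divides by `Q` (the bookkeeping of the tree's `decorrelationToDilatedChowla_proof`).
* `meanFree_diag_sum` : the diagonal of the mean-free weight is `Σ_m u v − S S'/M`
  (`card (M,2M] = M`).
* `meanFree_engine_of_bounds` : hence `|Σ_m u v| ≤ A + 2B + S₀` as soon as `|S| ≤ S₀` and
  `|v| ≤ 1` pointwise (`|S S'|/M ≤ S₀` because `|S'| ≤ M`).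
* `stub_meanFreeEngine` : mean-free coset bounds (H1) and mean-free fan bounds (H2) at exponent
  `3/4 + ϑ`, `ϑ < 1/4`, plus the ONE-POINT bound `|S(n)| ≤ C·M^{1−κ}` (H3, depth `1 − κ`, the
  node's own depth) give the route's node `DilatedChowla` BY NAME, with
  `κ := min (1/4 − max ϑ₁ ϑ₂) κ₃` and `C := max C₁ 0 + 2·max C₂ 0 + max C₃ 0`
  (`M^{3/4+ϑᵢ}, M^{1−κ₃} ≤ M^{1−κ}` for `M ≥ 1`; `M = 0` is excluded by `1 ≤ n ≤ 2M`).

So the route can consume K1-type (mean-corrected) residuals with a one-point input of depth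
`1 − κ`, whereas the level-one term of the coset sum alone would need `3/4 − κ/2` (the line's K2).
-/

namespace Summit.Parity.GeneralizedHardyLittlewood.Theorems.CosetDecorrelation.FareyLevelMeanCoupling

open Summit.Parity.GeneralizedHardyLittlewood.Theorems
open Summit.Parity.GeneralizedHardyLittlewood.Theses.LiouvilleMAD

/-- **Divisor-switch transfer for an arbitrary weight** (`M ≥ 1`, `Q = ⌊√M⌋ + 1`, `J = [Q,2Q)`):
if every coset sum `Σ_{(m,m') ∈ (M,2M]², m ≡ m' (j)} f(m,m')`, `j ∈ J`, is at most `A` in absolute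
value and every fan sum `Σ_{j∈J} Σ_{m − m' = kj} f(m,m')`, `k ≠ 0`, is at most `B`, then the
diagonal satisfies `|Σ_{m ∈ (M,2M]} f(m,m)| ≤ A + 2B`.  Proof: the exact identity
`decorrelationToDilatedChowla_divisor_switch`, the empty fans `|k| ≥ Q`
(`decorrelationToDilatedChowla_fan_eq_zero`, as `Q² > M`), at most `2Q − 1` remaining `k`, divide
by `Q`. [folklore: Duke–Friedlander–Iwaniec divisor switching, bookkeeping of the tree's
`decorrelationToDilatedChowla_proof`] -/
theorem meanFree_divisorSwitch_bound (f : ℕ → ℕ → ℝ) {M : ℕ} (hM : 0 < M) {A B : ℝ}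
    (hT : ∀ j : ℕ, Nat.sqrt M + 1 ≤ j → j < 2 * (Nat.sqrt M + 1) →
      |∑ p ∈ (Finset.Ioc M (2 * M) ×ˢ Finset.Ioc M (2 * M)).filter
          (fun p : ℕ × ℕ => p.1 ≡ p.2 [MOD j]), f p.1 p.2| ≤ A)
    (hR : ∀ k : ℤ, k ≠ 0 →
      |∑ j ∈ Finset.Ico (Nat.sqrt M + 1) (2 * (Nat.sqrt M + 1)),
        ∑ p ∈ (Finset.Ioc M (2 * M) ×ˢ Finset.Ioc M (2 * M)).filter
          (fun p : ℕ × ℕ => (p.1 : ℤ) - p.2 = k * (j : ℤ)), f p.1 p.2| ≤ B) :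
    |∑ m ∈ Finset.Ioc M (2 * M), f m m| ≤ A + 2 * B := by
  set Q : ℕ := Nat.sqrt M + 1 with hQdef
  set S : ℝ := ∑ m ∈ Finset.Ioc M (2 * M), f m m with hS
  set T : ℕ → ℝ := fun j => ∑ p ∈ (Finset.Ioc M (2 * M) ×ˢ Finset.Ioc M (2 * M)).filter
      (fun p : ℕ × ℕ => p.1 ≡ p.2 [MOD j]), f p.1 p.2 with hTdef
  set R : ℤ → ℝ := fun k => ∑ j ∈ Finset.Ico Q (2 * Q),
      ∑ p ∈ (Finset.Ioc M (2 * M) ×ˢ Finset.Ioc M (2 * M)).filter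
        (fun p : ℕ × ℕ => (p.1 : ℤ) - p.2 = k * (j : ℤ)), f p.1 p.2 with hRdef
  have hQpos : (0 : ℝ) < Q := by positivity
  have hQ1 : 1 ≤ Q := by omega
  have hMQ : M < Q * Q := Nat.lt_succ_sqrt M
  have hcard : ((Finset.Ico Q (2 * Q)).card : ℝ) = Q := by
    rw [Nat.card_Ico, show 2 * Q - Q = Q by omega]
  -- a fan bound at `k = 1` shows `0 ≤ B`
  have hB : 0 ≤ B := (abs_nonneg _).trans (hR 1 one_ne_zero)
  -- divisor switching
  have hDS := decorrelationToDilatedChowla_divisor_switch f M Q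
  rw [hcard] at hDS
  have hQS : (Q : ℝ) * S = ∑ j ∈ Finset.Ico Q (2 * Q), T j -
      ∑ k ∈ (Finset.Icc (-(M : ℤ)) M).erase 0, R k := by
    rw [← hDS]
    ring
  -- coset bound
  have hTb : ∑ j ∈ Finset.Ico Q (2 * Q), |T j| ≤ (Q : ℝ) * A := by
    rw [← hcard, ← nsmul_eq_mul, ← Finset.sum_const]
    refine Finset.sum_le_sum fun j hj => ?_
    rw [Finset.mem_Ico] at hj
    exact hT j hj.1 hj.2
  -- fan bound: only `|k| < Q` contributes
  have hRb : ∑ k ∈ (Finset.Icc (-(M : ℤ)) M).erase 0, |R k| ≤ (2 * (Q : ℝ) - 1) * B := by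
    set K := ((Finset.Icc (-(M : ℤ)) M).erase 0).filter (fun k : ℤ => |k| < Q) with hK
    have hsub : K ⊆ (Finset.Icc (-(M : ℤ)) M).erase 0 := Finset.filter_subset _ _
    have hzero : ∀ k ∈ (Finset.Icc (-(M : ℤ)) M).erase 0, k ∉ K → |R k| = 0 := by
      intro k hk hkK
      have hkQ : (Q : ℤ) ≤ |k| := by
        by_contra h
        exact hkK (Finset.mem_filter.mpr ⟨hk, lt_of_not_ge h⟩)
      rw [abs_eq_zero]
      refine Finset.sum_eq_zero fun j hj => ?_
      rw [Finset.mem_Ico] at hj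
      exact decorrelationToDilatedChowla_fan_eq_zero (fun p : ℕ × ℕ => f p.1 p.2) hMQ hj.1 hkQ
    rw [← Finset.sum_subset hsub hzero]
    have hKcard : (K.card : ℝ) ≤ 2 * (Q : ℝ) - 1 := by
      have hKsub : K ⊆ Finset.Ioo (-(Q : ℤ)) Q := by
        intro k hk
        rw [hK, Finset.mem_filter] at hk
        rw [Finset.mem_Ioo]
        exact abs_lt.mp hk.2
      have h1 := Finset.card_le_card hKsub
      rw [Int.card_Ioo] at h1
      have h2 : K.card + 1 ≤ 2 * Q := by omega
      have h3 : (K.card : ℝ) + 1 ≤ 2 * Q := by exact_mod_cast h2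
      linarith
    calc ∑ k ∈ K, |R k| ≤ ∑ _k ∈ K, B := by
          refine Finset.sum_le_sum fun k hk => ?_
          have hk0 : k ≠ 0 := (Finset.mem_erase.mp (hsub hk)).1
          exact hR k hk0
      _ = (K.card : ℝ) * B := by rw [Finset.sum_const, nsmul_eq_mul]
      _ ≤ (2 * (Q : ℝ) - 1) * B := mul_le_mul_of_nonneg_right hKcard hB
  -- assemble: `Q·|S| ≤ Q·A + (2Q−1)·B ≤ Q·(A + 2B)`
  have hQabs : (Q : ℝ) * |S| ≤ (Q : ℝ) * A + (2 * (Q : ℝ) - 1) * B := by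
    have h1 : (Q : ℝ) * |S| = |(Q : ℝ) * S| := by
      rw [abs_mul, abs_of_pos hQpos]
    rw [h1, hQS]
    calc |∑ j ∈ Finset.Ico Q (2 * Q), T j - ∑ k ∈ (Finset.Icc (-(M : ℤ)) M).erase 0, R k|
        ≤ |∑ j ∈ Finset.Ico Q (2 * Q), T j| + |∑ k ∈ (Finset.Icc (-(M : ℤ)) M).erase 0, R k| :=
          abs_sub _ _
      _ ≤ ∑ j ∈ Finset.Ico Q (2 * Q), |T j| + ∑ k ∈ (Finset.Icc (-(M : ℤ)) M).erase 0, |R k| :=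
          add_le_add (Finset.abs_sum_le_sum_abs _ _) (Finset.abs_sum_le_sum_abs _ _)
      _ ≤ _ := add_le_add hTb hRb
  have h2 : (Q : ℝ) * |S| ≤ (Q : ℝ) * (A + 2 * B) := by nlinarith
  exact le_of_mul_le_mul_left h2 hQpos

/-- Expanding a product of shifted weights over a finite set:
`Σ_{m∈s} (u m − a)(v m − b) = Σ u v − b Σ u − a Σ v + |s|·ab`. [folklore] -/
theorem meanFree_sum_mul_sub (s : Finset ℕ) (u v : ℕ → ℝ) (a b : ℝ) :
    ∑ m ∈ s, (u m - a) * (v m - b) =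
      ∑ m ∈ s, u m * v m - b * ∑ m ∈ s, u m - a * ∑ m ∈ s, v m + (s.card : ℝ) * (a * b) := by
  have e : ∀ m ∈ s, (u m - a) * (v m - b) = u m * v m - b * u m - a * v m + a * b :=
    fun m _ => by ring
  rw [Finset.sum_congr rfl e, Finset.sum_add_distrib, Finset.sum_sub_distrib,
    Finset.sum_sub_distrib, Finset.sum_const, nsmul_eq_mul, ← Finset.mul_sum, ← Finset.mul_sum]

/-- **Diagonal of the mean-free weight** (`M ≥ 1`, so `card (M,2M] = M ≠ 0`): with `S = Σ u`,
`S' = Σ v` over `(M,2M]`, `Σ_m (u m − S/M)(v m − S'/M) = Σ_m u m v m − S S'/M`. [folklore] -/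
theorem meanFree_diag_sum (u v : ℕ → ℝ) {M : ℕ} (hM : 0 < M) :
    ∑ m ∈ Finset.Ioc M (2 * M),
        (u m - (∑ m ∈ Finset.Ioc M (2 * M), u m) / (M : ℝ)) *
          (v m - (∑ m ∈ Finset.Ioc M (2 * M), v m) / (M : ℝ)) =
      ∑ m ∈ Finset.Ioc M (2 * M), u m * v m -
        (∑ m ∈ Finset.Ioc M (2 * M), u m) * (∑ m ∈ Finset.Ioc M (2 * M), v m) / (M : ℝ) := by
  have hMne : (M : ℝ) ≠ 0 := by exact_mod_cast hM.ne'
  rw [meanFree_sum_mul_sub, Nat.card_Ioc, show 2 * M - M = M by omega]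
  field_simp
  ring

/-- **The mean-free engine for general weights** (`M ≥ 1`, `u, v : ℕ → ℝ` with `|v| ≤ 1`,
`S = Σ u`, `S' = Σ v` over `(M,2M]`): if the MEAN-FREE coset sums
`Σ_{m≡m' (j)} (u m − S/M)(v m' − S'/M)`, `j ∈ [⌊√M⌋+1, 2⌊√M⌋+2)`, are `≤ A` in absolute value, the
mean-free fan sums (`k ≠ 0`) are `≤ B`, and `|S| ≤ S₀`, then `|Σ_m u m v m| ≤ A + 2B + S₀`:
the divisor-switch transfer (`meanFree_divisorSwitch_bound`) bounds the mean-free diagonal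
`Σ u v − S S'/M` (`meanFree_diag_sum`) by `A + 2B`, and `|S S'|/M ≤ S₀` since `|S'| ≤ M`.
[folklore] -/
theorem meanFree_engine_of_bounds (u v : ℕ → ℝ) {M : ℕ} (hM : 0 < M) {A B S₀ : ℝ}
    (hv : ∀ m, |v m| ≤ 1)
    (hT : ∀ j : ℕ, Nat.sqrt M + 1 ≤ j → j < 2 * (Nat.sqrt M + 1) →
      |∑ p ∈ (Finset.Ioc M (2 * M) ×ˢ Finset.Ioc M (2 * M)).filter
          (fun p : ℕ × ℕ => p.1 ≡ p.2 [MOD j]),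
        (u p.1 - (∑ m ∈ Finset.Ioc M (2 * M), u m) / (M : ℝ)) *
          (v p.2 - (∑ m ∈ Finset.Ioc M (2 * M), v m) / (M : ℝ))| ≤ A)
    (hR : ∀ k : ℤ, k ≠ 0 →
      |∑ j ∈ Finset.Ico (Nat.sqrt M + 1) (2 * (Nat.sqrt M + 1)),
        ∑ p ∈ (Finset.Ioc M (2 * M) ×ˢ Finset.Ioc M (2 * M)).filter
          (fun p : ℕ × ℕ => (p.1 : ℤ) - p.2 = k * (j : ℤ)),
        (u p.1 - (∑ m ∈ Finset.Ioc M (2 * M), u m) / (M : ℝ)) *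
          (v p.2 - (∑ m ∈ Finset.Ioc M (2 * M), v m) / (M : ℝ))| ≤ B)
    (hS : |∑ m ∈ Finset.Ioc M (2 * M), u m| ≤ S₀) :
    |∑ m ∈ Finset.Ioc M (2 * M), u m * v m| ≤ A + 2 * B + S₀ := by
  have hMpos : (0 : ℝ) < M := by exact_mod_cast hM
  -- the divisor-switch transfer applied to the mean-free weight
  have h1 : |∑ m ∈ Finset.Ioc M (2 * M),
      (u m - (∑ m ∈ Finset.Ioc M (2 * M), u m) / (M : ℝ)) *
        (v m - (∑ m ∈ Finset.Ioc M (2 * M), v m) / (M : ℝ))| ≤ A + 2 * B :=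
    meanFree_divisorSwitch_bound
      (fun x y => (u x - (∑ m ∈ Finset.Ioc M (2 * M), u m) / (M : ℝ)) *
        (v y - (∑ m ∈ Finset.Ioc M (2 * M), v m) / (M : ℝ))) hM hT hR
  rw [meanFree_diag_sum u v hM] at h1
  -- the level-one term: `|S'| ≤ M`, hence `|S S'|/M ≤ S₀`
  have hS' : |∑ m ∈ Finset.Ioc M (2 * M), v m| ≤ M := by
    calc |∑ m ∈ Finset.Ioc M (2 * M), v m| ≤ ∑ m ∈ Finset.Ioc M (2 * M), |v m| :=
          Finset.abs_sum_le_sum_abs _ _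
      _ ≤ ∑ _m ∈ Finset.Ioc M (2 * M), (1 : ℝ) := Finset.sum_le_sum fun m _ => hv m
      _ = M := by
          rw [Finset.sum_const, Nat.card_Ioc, show 2 * M - M = M by omega, nsmul_eq_mul, mul_one]
  have hS₀ : 0 ≤ S₀ := (abs_nonneg _).trans hS
  have hSS' : |(∑ m ∈ Finset.Ioc M (2 * M), u m) * (∑ m ∈ Finset.Ioc M (2 * M), v m) / (M : ℝ)|
      ≤ S₀ := by
    rw [abs_div, abs_mul, abs_of_pos hMpos, div_le_iff₀ hMpos]
    exact mul_le_mul hS hS' (abs_nonneg _) hS₀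
  calc |∑ m ∈ Finset.Ioc M (2 * M), u m * v m|
      = |(∑ m ∈ Finset.Ioc M (2 * M), u m * v m -
            (∑ m ∈ Finset.Ioc M (2 * M), u m) * (∑ m ∈ Finset.Ioc M (2 * M), v m) / (M : ℝ)) +
          (∑ m ∈ Finset.Ioc M (2 * M), u m) * (∑ m ∈ Finset.Ioc M (2 * M), v m) / (M : ℝ)| := by
        rw [sub_add_cancel]
    _ ≤ |∑ m ∈ Finset.Ioc M (2 * M), u m * v m -
            (∑ m ∈ Finset.Ioc M (2 * M), u m) * (∑ m ∈ Finset.Ioc M (2 * M), v m) / (M : ℝ)| +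
          |(∑ m ∈ Finset.Ioc M (2 * M), u m) * (∑ m ∈ Finset.Ioc M (2 * M), v m) / (M : ℝ)| :=
        abs_add_le _ _
    _ ≤ A + 2 * B + S₀ := add_le_add h1 hSS'

/-- **STUB `stub_meanFreeEngine`** (line `SketchIdeator3`, IdeatorMemo3 §F3 made exact): MEAN-FREE
coset bounds (H1) and MEAN-FREE fan bounds (H2) at exponent `3/4 + ϑ`, `ϑ < 1/4`, together with the
ONE-POINT bound `|Σ_{m∈(M,2M]} λ(mn+c)| ≤ C·M^{1−κ}` (H3, depth `1 − κ`), imply the route's node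
`DilatedChowla` (by name).  With `u(m) = λ(mn+c)`, `v(m') = λ(m'n'+c)`, `S = Σ u`, `S' = Σ v`, the
parenthesised factors of H1/H2 are the mean-free weights `u − S/M`, `v − S'/M`; the engine
`meanFree_engine_of_bounds` (divisor switching at `Q = ⌊√M⌋ + 1`, empty fans for `|k| ≥ Q`,
diagonal `Σ u v − S S'/M`, `|S'| ≤ M`) gives
`|Σ_m u v| ≤ C₁ M^{3/4+ϑ₁} + 2 C₂ M^{3/4+ϑ₂} + C₃ M^{1−κ₃} ≤ (C₁⁺ + 2C₂⁺ + C₃⁺)·M^{1−κ}` for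
`κ := min (1/4 − max ϑ₁ ϑ₂) κ₃ > 0`, `M ≥ 1` (`Real.rpow_le_rpow_of_exponent_le`); `M = 0` is
excluded by `1 ≤ n ≤ 2M`. -/
theorem stub_meanFreeEngine :
    (∀ c : ℤ, c ≠ 0 → ∃ ϑ : ℝ, ϑ < 1 / 4 ∧ ∃ C : ℝ, ∀ M n n' j : ℕ, 1 ≤ n → 1 ≤ n' → n ≠ n' →
      n ≤ 2 * M → n' ≤ 2 * M → Nat.sqrt M + 1 ≤ j → j < 2 * (Nat.sqrt M + 1) →
        |∑ p ∈ (Finset.Ioc M (2 * M) ×ˢ Finset.Ioc M (2 * M)).filter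
            (fun p : ℕ × ℕ => p.1 ≡ p.2 [MOD j]),
          ((ArithmeticFunction.liouville (Int.toNat ((p.1 : ℤ) * n + c)) : ℝ)
            - (∑ m ∈ Finset.Ioc M (2 * M),
                (ArithmeticFunction.liouville (Int.toNat ((m : ℤ) * n + c)) : ℝ)) / (M : ℝ)) *
          ((ArithmeticFunction.liouville (Int.toNat ((p.2 : ℤ) * n' + c)) : ℝ)
            - (∑ m ∈ Finset.Ioc M (2 * M),
                (ArithmeticFunction.liouville (Int.toNat ((m : ℤ) * n' + c)) : ℝ)) / (M : ℝ))|
          ≤ C * (M : ℝ) ^ (3 / 4 + ϑ)) →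
    (∀ c : ℤ, c ≠ 0 → ∃ ϑ : ℝ, ϑ < 1 / 4 ∧ ∃ C : ℝ, ∀ M n n' : ℕ, ∀ k : ℤ, 1 ≤ n → 1 ≤ n' → n ≠ n' →
      n ≤ 2 * M → n' ≤ 2 * M → k ≠ 0 →
        |∑ j ∈ Finset.Ico (Nat.sqrt M + 1) (2 * (Nat.sqrt M + 1)),
          ∑ p ∈ (Finset.Ioc M (2 * M) ×ˢ Finset.Ioc M (2 * M)).filter
            (fun p : ℕ × ℕ => (p.1 : ℤ) - p.2 = k * (j : ℤ)),
          ((ArithmeticFunction.liouville (Int.toNat ((p.1 : ℤ) * n + c)) : ℝ)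
            - (∑ m ∈ Finset.Ioc M (2 * M),
                (ArithmeticFunction.liouville (Int.toNat ((m : ℤ) * n + c)) : ℝ)) / (M : ℝ)) *
          ((ArithmeticFunction.liouville (Int.toNat ((p.2 : ℤ) * n' + c)) : ℝ)
            - (∑ m ∈ Finset.Ioc M (2 * M),
                (ArithmeticFunction.liouville (Int.toNat ((m : ℤ) * n' + c)) : ℝ)) / (M : ℝ))|
          ≤ C * (M : ℝ) ^ (3 / 4 + ϑ)) →
    (∀ c : ℤ, c ≠ 0 → ∃ κ : ℝ, 0 < κ ∧ ∃ C : ℝ, ∀ M n : ℕ, 1 ≤ n → n ≤ 2 * M →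
      |∑ m ∈ Finset.Ioc M (2 * M), (ArithmeticFunction.liouville (Int.toNat ((m : ℤ) * n + c)) : ℝ)|
        ≤ C * (M : ℝ) ^ (1 - κ)) →
    Summit.Parity.GeneralizedHardyLittlewood.Theses.LiouvilleMAD.DilatedChowla := by
  intro h₁ h₂ h₃
  unfold Summit.Parity.GeneralizedHardyLittlewood.Theses.LiouvilleMAD.DilatedChowla
  intro c hc
  obtain ⟨ϑ₁, hϑ₁, C₁, hC₁⟩ := h₁ c hc
  obtain ⟨ϑ₂, hϑ₂, C₂, hC₂⟩ := h₂ c hc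
  obtain ⟨κ₃, hκ₃, C₃, hC₃⟩ := h₃ c hc
  refine ⟨min (1 / 4 - max ϑ₁ ϑ₂) κ₃, lt_min (by have := max_lt hϑ₁ hϑ₂; linarith) hκ₃,
    max C₁ 0 + 2 * max C₂ 0 + max C₃ 0, ?_⟩
  intro M n n' hn hn' hnn' hnM hn'M
  have hMpos : 0 < M := by omega
  have hM1 : (1 : ℝ) ≤ M := by exact_mod_cast hMpos
  -- the engine with `u = λ(·n+c)`, `v = λ(·n'+c)`, `A = C₁M^{3/4+ϑ₁}`, `B = C₂M^{3/4+ϑ₂}`,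
  -- `S₀ = C₃M^{1−κ₃}`
  have key := meanFree_engine_of_bounds
    (fun m => (ArithmeticFunction.liouville (Int.toNat ((m : ℤ) * n + c)) : ℝ))
    (fun m => (ArithmeticFunction.liouville (Int.toNat ((m : ℤ) * n' + c)) : ℝ)) hMpos
    (fun _ => Literature.NumberTheory.Sieve.abs_liouville_le_one _)
    (fun j hj hj' => hC₁ M n n' j hn hn' hnn' hnM hn'M hj hj')
    (fun k hk => hC₂ M n n' k hn hn' hnn' hnM hn'M hk) (hC₃ M n hn hnM)
  refine key.trans ?_
  -- exponents: everything is `≤ M^{1−κ}` for `M ≥ 1`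
  set κ : ℝ := min (1 / 4 - max ϑ₁ ϑ₂) κ₃ with hκ
  have hκ₁ : κ ≤ 1 / 4 - max ϑ₁ ϑ₂ := min_le_left _ _
  have hκ₂ : κ ≤ κ₃ := min_le_right _ _
  have he₁ : (M : ℝ) ^ (3 / 4 + ϑ₁) ≤ (M : ℝ) ^ (1 - κ) :=
    Real.rpow_le_rpow_of_exponent_le hM1 (by have := le_max_left ϑ₁ ϑ₂; linarith)
  have he₂ : (M : ℝ) ^ (3 / 4 + ϑ₂) ≤ (M : ℝ) ^ (1 - κ) :=
    Real.rpow_le_rpow_of_exponent_le hM1 (by have := le_max_right ϑ₁ ϑ₂; linarith)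
  have he₃ : (M : ℝ) ^ (1 - κ₃) ≤ (M : ℝ) ^ (1 - κ) :=
    Real.rpow_le_rpow_of_exponent_le hM1 (by linarith)
  have hX₁ : (0 : ℝ) ≤ (M : ℝ) ^ (3 / 4 + ϑ₁) := by positivity
  have hX₂ : (0 : ℝ) ≤ (M : ℝ) ^ (3 / 4 + ϑ₂) := by positivity
  have hX₃ : (0 : ℝ) ≤ (M : ℝ) ^ (1 - κ₃) := by positivity
  have h1 := mul_le_mul_of_nonneg_right (le_max_left C₁ 0) hX₁
  have h2 := mul_le_mul_of_nonneg_right (le_max_left C₂ 0) hX₂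
  have h3 := mul_le_mul_of_nonneg_right (le_max_left C₃ 0) hX₃
  have h1' := mul_le_mul_of_nonneg_left he₁ (le_max_right C₁ 0)
  have h2' := mul_le_mul_of_nonneg_left he₂ (le_max_right C₂ 0)
  have h3' := mul_le_mul_of_nonneg_left he₃ (le_max_right C₃ 0)
  linarith

end Summit.Parity.GeneralizedHardyLittlewood.Theorems.CosetDecorrelation.FareyLevelMeanCoupling
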